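import Summits.PneNP.PneNP.Theorems.SymmetryBudgetNoHiddenOrderBitValuationDefs
import Summits.PneNP.PneNP.Theorems.SymmetryBudgetNoHiddenOrderPerPathCGHeight

/-!
# `NoHiddenOrder` (stmt-PneNP-14781), (R2c) value layer I: the bit valuation — well-formedness, leaves and lifting

Route `PneNP/SymmetryBudget`; definitions in `SymmetryBudgetNoHiddenOrderBitValuationDefs.lean`.  Process colourings are
`refineIn` colourings, hence `< |block| ≤ n` (`refineIn_lt_card`): children and parts of well-formed instances are well
formed.  Then the two easy valuation axioms of the bit valuation: `good_leafVal` (along `someEnum`) and `good_lift` (the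
child colouring `refineIn G A (indiv col x)` refines `col`, so the bitwise colour read-back of `lift` recolours the child's
encoding into the parent's); and the row count `nrows` of an encoding (equal values ⇒ equal sizes, used by pasting).
The pasting axiom is in `…BitValuationCover.lean` / `…BitValuationEnum.lean`, the valuation and the root theorem in
`…BitValuationRoot.lean`.  Sorry-free; supports stmt-PneNP-14781.
-/

set_option linter.dupNamespace false -- `Summit.PneNP.PneNP.…` (D-0017 single-conjunct layout)

namespace Summit.PneNP.PneNP.Theorems

open Finset BranchSum

namespace CGBits

variable {V : Type*} [DecidableEq V] {G : SimpleGraph V} [DecidableRel G.Adj] {n : ℕ}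

/-! ### Well-formedness of process instances -/

/-- `refineIn` values are below the block size. [folklore] -/
theorem refineIn_lt_card {W : Finset V} (col : V → ℕ) {v : V} (hv : v ∈ W) : refineIn G W col v < W.card := by
  rw [refineIn_apply col hv]
  obtain ⟨k, hk⟩ : ∃ k, W.card = k + 1 := ⟨W.card - 1, (Nat.succ_pred_eq_of_pos (card_pos.2 ⟨v, hv⟩)).symm⟩
  rw [hk, Literature.Combinatorics.SimpleGraph.ocrIter_succ]
  have h := Literature.Combinatorics.SimpleGraph.ocrStep_lt_card (G := G.induce (W : Set V))
    (col := Literature.Combinatorics.SimpleGraph.ocrIter (G.induce (W : Set V)) (fun x : ↥(W : Set V) => col x) k)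
    ⟨v, mem_coe.2 hv⟩
  have hc : Fintype.card ↥(W : Set V) = W.card := by simp
  omega

/-- `refineIn` vanishes off the block. [folklore] -/
theorem refineIn_of_not_mem {W : Finset V} (col : V → ℕ) {v : V} (hv : v ∉ W) : refineIn G W col v = 0 := by
  unfold refineIn; rw [dif_neg hv]

/-- A refined instance on a block of `≤ n` vertices is well formed. [folklore] -/
theorem wf_refineIn {A : Finset V} (hA : A.Nonempty) (hAn : A.card ≤ n) (c : V → ℕ) :
    Wf n (⟨(A, refineIn G A c), hA⟩ : CGInst V) := fun _ hu => (refineIn_lt_card c hu).trans_le hAn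

/-- Children are well formed. [folklore] -/
theorem wf_cgChild [Fintype V] (hn : Fintype.card V ≤ n) (I : CGInst V) (x : V) : Wf n (cgChild G I x) :=
  fun _ hu => (refineIn_lt_card _ hu).trans_le ((card_le_univ _).trans hn)

/-- Parts of a well-formed instance are well formed. [folklore] -/
theorem wf_of_mem_cgParts {I J : CGInst V} (hI : Wf n I) (hJ : J ∈ cgParts G I) : Wf n J := by
  obtain ⟨hcol, hK⟩ := mem_cgParts_iff.1 hJ
  obtain ⟨w, -, hw⟩ := mem_image.1 hK
  intro u hu
  rw [hcol]
  exact hI u (swReach_subset _ _ w (hw ▸ hu))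

/-! ### Good values -/

omit [DecidableEq V] in
/-- `Good` on a well-formed instance. [folklore] -/
theorem good_iff_of_wf {I : CGInst V} (hI : Wf n I) {E : BVal n} :
    Good G n I E ↔ ∃ e, IsEnum n I.1.1 e ∧ E = bitEnc G n I.1.2 I.1.1.card e := by
  unfold Good; rw [if_pos hI]

omit [DecidableEq V] in
/-- `Good` on an ill-formed instance. [folklore] -/
theorem good_iff_of_not_wf {I : CGInst V} (hI : ¬ Wf n I) {E : BVal n} : Good G n I E ↔ E = leafVal G n I := by
  unfold Good; rw [if_neg hI]

omit [DecidableEq V] in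
/-- `someEnum` enumerates. [folklore] -/
theorem isEnum_someEnum [Fintype V] (hn : Fintype.card V ≤ n) (I : CGInst V) : IsEnum n I.1.1 (someEnum n I) where
  card_le := (card_le_univ _).trans hn
  mem i hi := by unfold someEnum; rw [dif_pos hi]; exact coe_mem _
  inj i j hi hj h := by
    unfold someEnum at h
    rw [dif_pos hi, dif_pos hj] at h
    have := I.1.1.equivFin.symm.injective (Subtype.ext h)
    exact Fin.ext (by simpa using congrArg Fin.val this)

omit [DecidableEq V] in
/-- **Leaves are good** (indeed `leafVal` is good on every instance). [folklore] -/
theorem good_leafVal [Fintype V] (hn : Fintype.card V ≤ n) (I : CGInst V) : Good G n I (leafVal G n I) := by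
  by_cases hI : Wf n I
  · exact (good_iff_of_wf hI).2 ⟨_, isEnum_someEnum hn I, rfl⟩
  · exact (good_iff_of_not_wf hI).2 rfl

/-- Two bitvectors agree iff they agree on colour bits and on adjacency bits. [folklore] -/
theorem bval_ext {E E' : BVal n} (hc : ∀ i c, E (cIdx i c) = E' (cIdx i c)) (ha : ∀ i j, E (aIdx i j) = E' (aIdx i j)) :
    E = E' := by
  funext b
  rcases bit_cases b with ⟨i, c, rfl⟩ | ⟨i, j, rfl⟩
  · exact hc i c
  · exact ha i j

/-- **(P2) lifting a good value of the child gives a good value.** [folklore] -/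
theorem good_lift [Fintype V] (hn : Fintype.card V ≤ n) (I : CGInst V) (A : Finset V) (ch : V → CGInst V) (x : V)
    (E : BVal n) (hs : cgStep G I = .orNode A ch) (hE : Good G n (ch x) E) : Good G n I (lift G n I x E) := by
  obtain ⟨-, -, rfl, rfl⟩ := cgStep_eq_orNode_iff.1 hs
  by_cases hI : Wf n I
  · obtain ⟨e, he, rfl⟩ := (good_iff_of_wf (wf_cgChild hn I x)).1 hE
    change IsEnum n I.1.1 e at he
    refine (good_iff_of_wf hI).2 ⟨e, he, ?_⟩
    show lift G n I x (bitEnc G n (refineIn G I.1.1 (indiv I.1.2 x)) I.1.1.card e) = bitEnc G n I.1.2 I.1.1.card e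
    unfold lift
    rw [if_pos hI]
    refine bval_ext (fun i c => ?_) (fun i j => by simp)
    simp only [bdec_cIdx, bitEnc_cIdx, decide_eq_true_eq]
    apply decide_eq_decide.2
    by_cases hi : (i : ℕ) < I.1.1.card
    · simp only [hi, true_and]
      have hei : e i ∈ I.1.1 := he.mem i hi
      constructor
      · rintro ⟨c', hc', u, hu, huc', huc⟩
        rw [← huc]
        exact indiv_refines I.1.2 x (refineIn_refines _ hei hu (hc'.trans huc'.symm))
      · intro hc
        have hlt : refineIn G I.1.1 (indiv I.1.2 x) (e i) < n := (refineIn_lt_card _ hei).trans_le he.card_le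
        exact ⟨⟨_, hlt⟩, rfl, e i, hei, rfl, hc⟩
    · simp [hi]
  · rw [good_iff_of_not_wf hI]
    unfold lift; rw [if_neg hI]

/-! ### Rows of an encoding -/

/-- The number of rows of a value: rows carrying a colour bit. [folklore] -/
noncomputable def nrows (E : BVal n) : ℕ := (univ.filter fun i : Fin n => ∃ c : Fin n, E (cIdx i c) = true).card

omit [DecidableEq V] in
/-- An encoding with colours `< n` on its `s ≤ n` rows has `s` rows. [folklore] -/
theorem nrows_bitEnc {col : V → ℕ} {s : ℕ} {e : Fin n → V} (_hs : s ≤ n) (hcol : ∀ i : Fin n, (i : ℕ) < s → col (e i) < n) :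
    nrows (bitEnc G n col s e) = s := by
  unfold nrows
  have hfilter : (univ.filter fun i : Fin n => ∃ c : Fin n, bitEnc G n col s e (cIdx i c) = true) =
      univ.filter fun i : Fin n => (i : ℕ) < s := by
    ext i
    simp only [mem_filter, mem_univ, true_and, bitEnc_cIdx, decide_eq_true_eq]
    exact ⟨fun ⟨c, hi, _⟩ => hi, fun hi => ⟨⟨col (e i), hcol i hi⟩, hi, rfl⟩⟩
  rw [hfilter]
  have himage : (univ.filter fun i : Fin n => (i : ℕ) < s).image Fin.val = range s := by
    ext k
    simp only [mem_image, mem_filter, mem_univ, true_and, mem_range]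
    exact ⟨fun ⟨i, hi, hik⟩ => hik ▸ hi, fun hk => ⟨⟨k, by omega⟩, hk, rfl⟩⟩
  rw [← card_image_of_injective _ Fin.val_injective, himage, card_range]

end CGBits

end Summit.PneNP.PneNP.Theorems
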